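import Mathlib.Order.Ideal
import Mathlib.Data.Set.Countable
import Mathlib.Data.Set.BoolIndicator
import Mathlib.Computability.Language
import HarnessLib

/-!
# Generic oracles: Cohen conditions, dense sets of conditions, genericity and the existence of generic oracles

Topic `Literature/Computability/Complexity` (oracle constructions; companion of `Oracle.lean`,
`BakerGillSolovay.lean`). This file formalizes the *generic oracle* tool of

* L. Fortnow, J. Rogers, *Complexity limitations on quantum computation*, JCSS 59 (1999)
  240–252 = arXiv:cs/9811023 [FortnowRogers1999JCSS], §2.6 "Generic oracles" (p. 4, arXiv
  numbering): "A *condition* is a partial function from `Σ*` to `{0,1}`. A condition `σ` *extends*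
  another condition `τ` if, for all `x ∈ dom τ`, `σ(x) = τ(x)`. An oracle `A` extends a condition
  `σ` if `A`'s characteristic function extends `σ`. […] A condition `σ` *satisfies* a requirement
  if any oracle extending `σ` satisfies it. A set of conditions `S` is *dense* if, for every
  condition `τ`, there is a condition `σ ∈ S` that extends `τ`. […] we impose the restriction that
  all conditions have finite domains. […] An oracle `A` *meets* a set of conditions `S` if there is
  some `σ` in `S` that is extended by `A`. A *generic oracle* is one that meets every dense
  definable set of conditions. […] Restrictions can be set on conditions to achieve a desired
  separation" (the `UP ∩ coUP`-conditions of their §4);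
* S. Fenner, L. Fortnow, S. Kurtz, L. Li, *An oracle builder's toolkit*, Inform. and Comput. 182
  (2003) 95–136 [FennerFortnowKurtzLi2003IC], §2 p. 5 (partial characteristic functions,
  "`f` extends `g`", compatibility), §4 p. 16 ("Cohen forcing, where the conditions are all the
  partial characteristic functions on `ω` with finite domain"; Lemma 4.1: "A set `G` is Cohen
  generic if and only if `G` meets every dense set of strings that is (coded as) an arithmetically
  definable element of `2^ω`"), §3.1 p. 9 ("`A` meets `S` if `σ ≺ A` for some `σ ∈ S`"; "`S` is
  dense if for every `σ` there is a `τ ∈ S` with `σ ⊇ τ`") and **Lemma 3.12** (Existence of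
  generic sets, p. 11): "the set of `𝒢`-generic sets is dense, i.e., for every `γ` there is a
  `𝒢`-generic set `G ∈ γ`", proved by a chain `γ = γ₋₁ ⊇ γ₀ ⊇ γ₁ ⊇ ⋯` meeting the countably many
  relevant dense sets one at a time.

**What this file adds** (all definitions real, all theorems proved).

* `CohenCondition`: finite partial functions `{0,1}* ⇀ {0,1}` (`val : List Bool → Option Bool`
  with finite domain), partially ordered by extension — `σ ≤ τ` iff `τ` extends `σ` (the
  information order; Fenner–Fortnow–Kurtz–Li's `τ ⪰ σ`) — with least element the empty
  condition `⊥`; `CohenCondition.restrict A s`, the condition recording an oracle `A` on a finite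
  set `s` of strings; the one-point extension `CohenCondition.define σ q b` and fresh strings
  (`CohenCondition.exists_not_mem_dom`: a condition leaves some string of any infinite set
  undecided), whence the basic dense sets `isDense_setOf_mem_dom`,
  `isDense_setOf_exists_val_eq` of finite-extension arguments.
* `CohenCondition.ExtendedBy σ A` ("the oracle `A` extends `σ`"), `CohenCondition.Forces σ R`
  ("`σ` satisfies the requirement `R`": every oracle extending `σ` has property `R`),
  `CohenCondition.Meets A S`, and density `CohenCondition.IsDense S` — by definition Mathlib's
  `IsCofinal S` for the extension order, i.e. literally "for every condition `τ` there is
  `σ ∈ S` extending `τ`" (`isDense_iff`).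
* `IsGeneric 𝒮 G`: the oracle `G` meets every dense member of the family `𝒮` of sets of
  conditions. The printed notions are the instances `𝒮 =` the (countably many) definable sets of
  conditions — `Π¹₁` for Fortnow–Rogers, arithmetical (Cohen genericity, possibly relative to a
  further oracle `B`, Fenner–Fortnow–Kurtz–Li §3.2) — and every proof by genericity uses only
  countably many explicitly given dense sets; definability itself is not formalized, the family
  is a parameter. `IsGenericIn P 𝒮 G` is the same for conditions *restricted* to a class `P`
  (density and meeting inside `P`), as for Fortnow–Rogers' `UP ∩ coUP`-generic oracles.
* PROVED: the genericity lemma `IsGeneric.of_forces` (if the conditions forcing `R` form a dense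
  member of `𝒮`, every `𝒮`-generic oracle satisfies `R` — the way requirements are met "by finite
  extension"), monotonicity and union in `𝒮`, and the **existence of generic oracles for countable
  families** through any prescribed condition: `exists_extendedBy_isGenericIn`,
  `exists_extendedBy_isGeneric`, `exists_isGeneric` (Fenner–Fortnow–Kurtz–Li, Lemma 3.12, for
  finite-function forcing). The proof is Mathlib's Rasiowa–Sikorski lemma
  (`Order.idealOfCofinals`: a countable family of cofinal sets of a preorder is met by an ideal
  through any point) followed by `CohenCondition.extendedBy_oracleOf`: a directed set of
  conditions is simultaneously extended by the oracle of strings that some member makes true.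

Consumers: the level-2 decomposition of Fortnow–Rogers' Cor. 3.7 / Fenner–Fortnow–Kurtz–Li's
Thm. 6.18 (2) (`Literature/Barriers/QuantumAdvantage/FortnowRogersOracle.lean`: a `PSPACE`-complete
set joined with a Cohen generic), and prospectively Fortnow–Rogers' Thm. 4.2 (`UP ∩ coUP`-generics)
and the "any Cohen generic separates `P` from `NP` / the polynomial hierarchy" remarks
(Fenner–Fortnow–Kurtz–Li §1 p. 3).

## Design notes

* Conditions are bundled with the finiteness of their domain (Fortnow–Rogers: "we impose the
  restriction that all conditions have finite domains"; Fenner–Fortnow–Kurtz–Li §4): density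
  quantifies over conditions, so the carrier type fixes the meaning of "dense". Fortnow–Rogers'
  further standing convention (a condition defined on some string of a length is defined on all
  strings of that length) is a cofinal subclass and is not built in; use `IsGenericIn` with that
  class as `P` if it is wanted literally.
* The order is Mathlib-facing: `σ ≤ τ` means `τ` carries more information, so that "dense" is
  `IsCofinal`, "`S` is dense among `P`-conditions" is `IsCofinalFor P (S ∩ P)`, and the generic
  filter of the existence proof is an `Order.Ideal` (Fenner–Fortnow–Kurtz–Li, Def. 3.6, write the
  reverse inclusion of perfect sets; Mathlib's `Order.Ideal` docstring notes the same reversal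
  for the Rasiowa–Sikorski lemma).
* Oracles are `Language Bool` (`= Set (List Bool)`), as for `Oracle.ofLanguage` and the
  relativized classes of the tree; no machine model is needed here.
* What is NOT here: definability of sets of conditions (arithmetical / `Π¹₁`), the forcing
  relation on sentences and "forcing = truth" (Fenner–Fortnow–Kurtz–Li §3), other notions of
  genericity (`SP`-generics, random oracles as `R`-generics), and any particular dense set.

## References

* [FortnowRogers1999JCSS] §2.6 (p. 4, arXiv numbering), read via `lit read arxiv:cs/9811023`.
* [FennerFortnowKurtzLi2003IC] §2 p. 5, §3.1 pp. 8–11 (Defs. 3.3, 3.6, 3.7, Lemma 3.12), §3.2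
  p. 14, §4 p. 16 (Lemma 4.1), read via `lit read doi:10.1016/s0890-5401(03)00018-x`.
* Mathlib: `IsCofinal`, `IsCofinalFor` (`Mathlib/Order/Bounds/Defs.lean`), `Order.Ideal`,
  `Order.Cofinal`, `Order.idealOfCofinals`, `Order.cofinal_meets_idealOfCofinals` (the
  Rasiowa–Sikorski lemma, `Mathlib/Order/Ideal.lean`), `Set.Countable.toEncodable`.
-/

namespace Literature.Computability.Complexity

/-! ### Conditions -/

/-- A **(Cohen) condition**: a partial function from strings to bits with finite domain — a finite
piece of the characteristic function of an oracle under construction (`val q = none`: the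
membership of `q` is not yet decided). [cite: FortnowRogers1999JCSS, §2.6 (arXiv numbering)] -/
structure CohenCondition where
  /-- The partial characteristic function (`none` = undetermined). -/
  val : List Bool → Option Bool
  /-- The domain is finite. -/
  finite_dom : {q | val q ≠ none}.Finite

namespace CohenCondition

variable {σ τ : CohenCondition} {A B : Language Bool}

/-- Two conditions with the same partial function are equal. [folklore] -/
@[ext] theorem ext' (h : σ.val = τ.val) : σ = τ := by
  cases σ; cases τ; cases h; rfl

/-- The domain `dom σ = {q | σ(q) is defined}` of a condition. [cite: FennerFortnowKurtzLi2003IC, §2 p. 5] -/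
def dom (σ : CohenCondition) : Set (List Bool) :=
  {q | σ.val q ≠ none}

/-- The domain of a condition is finite. [cite: FortnowRogers1999JCSS, §2.6 (arXiv numbering)] -/
theorem dom_finite (σ : CohenCondition) : σ.dom.Finite :=
  σ.finite_dom

/-- Unfolding lemma for `dom`. [folklore] -/
theorem mem_dom_iff {q : List Bool} : q ∈ σ.dom ↔ σ.val q ≠ none :=
  Iff.rfl

/-- **The extension order**: `σ ≤ τ` iff `τ` extends `σ`, i.e. `τ` is defined and agrees with `σ`
wherever `σ` is defined ("`dom(g) ⊆ dom(f)` and `f` agrees with `g` on `g`'s domain"). A partial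
order (information order: larger = more determined). [cite: FennerFortnowKurtzLi2003IC, §2 p. 5] [cite: FortnowRogers1999JCSS, §2.6 (arXiv numbering)] -/
instance instPartialOrder : PartialOrder CohenCondition where
  le σ τ := ∀ (q : List Bool) (b : Bool), σ.val q = some b → τ.val q = some b
  le_refl _ _ _ h := h
  le_trans _ _ _ h₁ h₂ q b h := h₂ q b (h₁ q b h)
  le_antisymm σ τ h₁ h₂ := by
    apply CohenCondition.ext'
    funext q
    cases hσ : σ.val q with
    | none =>
      cases hτ : τ.val q with
      | none => rfl
      | some b =>
        have h := h₂ q b hτ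
        rw [hσ] at h
        exact absurd h (by simp)
    | some b => exact (h₁ q b hσ).symm

/-- Unfolding lemma for the extension order. [cite: FennerFortnowKurtzLi2003IC, §2 p. 5] -/
theorem le_iff : σ ≤ τ ↔ ∀ (q : List Bool) (b : Bool), σ.val q = some b → τ.val q = some b :=
  Iff.rfl

/-- An extension is defined wherever the extended condition is. [cite: FennerFortnowKurtzLi2003IC, §2 p. 5] -/
theorem dom_mono (h : σ ≤ τ) : σ.dom ⊆ τ.dom := by
  intro q hq
  obtain ⟨b, hb⟩ := Option.ne_none_iff_exists'.1 hq
  rw [mem_dom_iff, h q b hb]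
  exact Option.some_ne_none b

/-- **The empty condition** (nothing decided) is the least condition: every condition extends it.
[cite: FennerFortnowKurtzLi2003IC, §2 p. 5 (the empty string `ε` as a condition)] -/
instance instOrderBot : OrderBot CohenCondition where
  bot := ⟨fun _ => none, by simp⟩
  bot_le _ _ _ h := absurd h (by simp)

/-- The empty condition is nowhere defined. [folklore] -/
@[simp] theorem val_bot (q : List Bool) : (⊥ : CohenCondition).val q = none :=
  rfl

/-! ### Oracles extending a condition; requirements; density; meeting -/

/-- **The oracle `A` extends the condition `σ`**: `A`'s characteristic function extends `σ`
(`σ(q) = 1 ⇒ q ∈ A`, `σ(q) = 0 ⇒ q ∉ A`). Fenner–Fortnow–Kurtz–Li write `σ ≺ A`.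
[cite: FortnowRogers1999JCSS, §2.6 (arXiv numbering)] [cite: FennerFortnowKurtzLi2003IC, §3.1 p. 9] -/
def ExtendedBy (σ : CohenCondition) (A : Language Bool) : Prop :=
  ∀ (q : List Bool) (b : Bool), σ.val q = some b → (q ∈ A ↔ b = true)

/-- Reading off membership from a condition an oracle extends. [folklore] -/
theorem ExtendedBy.mem_iff (h : σ.ExtendedBy A) {q : List Bool} {b : Bool} (hq : σ.val q = some b) :
    q ∈ A ↔ b = true :=
  h q b hq

/-- If `A` extends `τ` and `τ` extends `σ` then `A` extends `σ`. [cite: FortnowRogers1999JCSS, §2.6 (arXiv numbering)] -/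
theorem ExtendedBy.anti (h : σ ≤ τ) (hτ : τ.ExtendedBy A) : σ.ExtendedBy A :=
  fun q b hq => hτ q b (h q b hq)

/-- Every oracle extends the empty condition. [folklore] -/
theorem extendedBy_bot (A : Language Bool) : (⊥ : CohenCondition).ExtendedBy A :=
  fun _ _ h => absurd h (by simp)

/-- Two oracles extending the same condition agree on its domain. [folklore] -/
theorem ExtendedBy.mem_iff_mem (hA : σ.ExtendedBy A) (hB : σ.ExtendedBy B) {q : List Bool}
    (hq : q ∈ σ.dom) : q ∈ A ↔ q ∈ B := by
  obtain ⟨b, hb⟩ := Option.ne_none_iff_exists'.1 hq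
  rw [hA.mem_iff hb, hB.mem_iff hb]

/-- **`σ` satisfies (forces) the requirement `R`**: every oracle extending `σ` has the property
`R` ("A condition `σ` satisfies a requirement if any oracle extending `σ` satisfies it").
[cite: FortnowRogers1999JCSS, §2.6 (arXiv numbering)] -/
def Forces (σ : CohenCondition) (R : Language Bool → Prop) : Prop :=
  ∀ A : Language Bool, σ.ExtendedBy A → R A

/-- Forcing is preserved under extension. [cite: FennerFortnowKurtzLi2003IC, §3.1 p. 9 ("if `γ ⊩ φ` and `δ ⊆ γ` then `δ ⊩ φ`")] -/
theorem Forces.mono {R : Language Bool → Prop} (h : σ ≤ τ) (hσ : σ.Forces R) : τ.Forces R :=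
  fun A hA => hσ A (hA.anti h)

/-- Forcing is monotone in the requirement. [folklore] -/
theorem Forces.imp {R R' : Language Bool → Prop} (hσ : σ.Forces R) (h : ∀ A, R A → R' A) :
    σ.Forces R' :=
  fun A hA => h A (hσ A hA)

/-- **Density**: `S` is dense iff every condition is extended by some member of `S` — by
definition Mathlib's `IsCofinal S` for the extension order (`isDense_iff`).
[cite: FortnowRogers1999JCSS, §2.6 (arXiv numbering)] [cite: FennerFortnowKurtzLi2003IC, §3.1 p. 9] -/
abbrev IsDense (S : Set CohenCondition) : Prop :=
  IsCofinal S

/-- "A set of conditions `S` is dense if, for every condition `τ`, there is a condition `σ ∈ S`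
that extends `τ`" (definitional unfolding). [cite: FortnowRogers1999JCSS, §2.6 (arXiv numbering)] -/
theorem isDense_iff {S : Set CohenCondition} : IsDense S ↔ ∀ τ : CohenCondition, ∃ σ ∈ S, τ ≤ σ :=
  Iff.rfl

/-- **The oracle `A` meets the set of conditions `S`**: `A` extends some member of `S`.
[cite: FortnowRogers1999JCSS, §2.6 (arXiv numbering)] [cite: FennerFortnowKurtzLi2003IC, §3.1 p. 9] -/
def Meets (A : Language Bool) (S : Set CohenCondition) : Prop :=
  ∃ σ ∈ S, σ.ExtendedBy A

/-- Meeting is monotone in the set of conditions. [folklore] -/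
theorem Meets.mono {S T : Set CohenCondition} (h : S ⊆ T) (hA : Meets A S) : Meets A T := by
  obtain ⟨σ, hσ, hσA⟩ := hA
  exact ⟨σ, h hσ, hσA⟩

/-- An oracle meeting a set of conditions all of which force `R` satisfies `R`.
[cite: FortnowRogers1999JCSS, §2.6 (arXiv numbering)] -/
theorem Meets.of_forces {S : Set CohenCondition} {R : Language Bool → Prop} (hA : Meets A S)
    (hS : ∀ σ ∈ S, σ.Forces R) : R A := by
  obtain ⟨σ, hσ, hσA⟩ := hA
  exact hS σ hσ A hσA

/-! ### Restricting an oracle to a finite set of strings -/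

/-- `restrict A s`: the condition recording the oracle `A` on the finite set of strings `s`
(defined exactly on `s`, with `A`'s bits). [cite: FennerFortnowKurtzLi2003IC, §4 p. 17 (proof of Lemma 4.3: finitely much of `A`)] -/
noncomputable def restrict (A : Language Bool) (s : Finset (List Bool)) : CohenCondition where
  val q := if q ∈ s then some (Set.boolIndicator A q) else none
  finite_dom := s.finite_toSet.subset fun q hq => by
    by_contra h
    exact hq (if_neg h)

/-- The value of `restrict A s` on `s`. [folklore] -/
theorem val_restrict_of_mem {s : Finset (List Bool)} {q : List Bool} (hq : q ∈ s) :
    (restrict A s).val q = some (Set.boolIndicator A q) :=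
  if_pos hq

/-- The value of `restrict A s` off `s`. [folklore] -/
theorem val_restrict_of_not_mem {s : Finset (List Bool)} {q : List Bool} (hq : q ∉ s) :
    (restrict A s).val q = none :=
  if_neg hq

/-- The domain of `restrict A s` is `s`. [folklore] -/
theorem dom_restrict (A : Language Bool) (s : Finset (List Bool)) : (restrict A s).dom = ↑s := by
  ext q
  by_cases hq : q ∈ s
  · simp [mem_dom_iff, val_restrict_of_mem hq, hq]
  · simp [mem_dom_iff, val_restrict_of_not_mem hq, hq]

/-- `A` extends its own restrictions. [cite: FennerFortnowKurtzLi2003IC, §4 p. 17] -/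
theorem extendedBy_restrict (A : Language Bool) (s : Finset (List Bool)) :
    (restrict A s).ExtendedBy A := by
  intro q b hq
  by_cases hqs : q ∈ s
  · rw [val_restrict_of_mem hqs, Option.some.injEq] at hq
    rw [← hq]
    exact Set.mem_iff_boolIndicator _ _
  · rw [val_restrict_of_not_mem hqs] at hq
    exact absurd hq (by simp)

/-- A condition extended by `A` lies below every restriction of `A` to a finite set containing its
domain: finite pieces of an oracle can always be enlarged inside the oracle. [cite: FennerFortnowKurtzLi2003IC, §4 p. 17] -/
theorem le_restrict_of_extendedBy (h : τ.ExtendedBy A) {s : Finset (List Bool)} (hs : τ.dom ⊆ ↑s) :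
    τ ≤ restrict A s := by
  intro q b hq
  have hqs : q ∈ s := hs (by rw [mem_dom_iff, hq]; exact Option.some_ne_none b)
  rw [val_restrict_of_mem hqs]
  congr 1
  rcases Bool.eq_false_or_eq_true b with rfl | rfl
  · exact (Set.mem_iff_boolIndicator _ _).1 ((h q true hq).2 rfl)
  · exact (Set.notMem_iff_boolIndicator _ _).1 fun hqA => Bool.false_ne_true ((h q false hq).1 hqA)

/-- Every condition extended by `A` is below a restriction of `A` (to its own domain).
[cite: FennerFortnowKurtzLi2003IC, §4 p. 17] -/
theorem exists_le_restrict (h : τ.ExtendedBy A) : ∃ s : Finset (List Bool), τ ≤ restrict A s :=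
  ⟨τ.dom_finite.toFinset, le_restrict_of_extendedBy h (by simp)⟩

/-! ### One-point extensions and fresh strings (finite-extension arguments) -/

/-- `σ.define q b`: the condition `σ` with the string `q` decided — as `σ` decides it if it does,
as `b` otherwise (a one-point finite extension). [cite: FortnowRogers1999JCSS, §2.6 (arXiv numbering)] -/
def define (σ : CohenCondition) (q : List Bool) (b : Bool) : CohenCondition where
  val q' := if q' = q then some ((σ.val q).getD b) else σ.val q'
  finite_dom := (σ.dom_finite.insert q).subset fun q' hq' => by
    by_cases h : q' = q
    · exact Or.inl h
    · exact Or.inr (show σ.val q' ≠ none by simpa [h] using hq')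

/-- The value of a one-point extension at the new string. [folklore] -/
@[simp] theorem val_define_self (q : List Bool) (b : Bool) :
    (σ.define q b).val q = some ((σ.val q).getD b) :=
  if_pos rfl

/-- A one-point extension agrees with the condition elsewhere. [folklore] -/
theorem val_define_of_ne {q q' : List Bool} (b : Bool) (h : q' ≠ q) :
    (σ.define q b).val q' = σ.val q' :=
  if_neg h

/-- At a fresh string the one-point extension takes the prescribed value. [folklore] -/
theorem val_define_self_of_not_mem {q : List Bool} (b : Bool) (h : q ∉ σ.dom) :
    (σ.define q b).val q = some b := by
  rw [mem_dom_iff, not_not] at h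
  rw [val_define_self, h, Option.getD_none]

/-- The new string is decided by the one-point extension. [folklore] -/
theorem mem_dom_define_self (q : List Bool) (b : Bool) : q ∈ (σ.define q b).dom := by
  rw [mem_dom_iff, val_define_self]
  exact Option.some_ne_none _

/-- A one-point extension is an extension. [cite: FortnowRogers1999JCSS, §2.6 (arXiv numbering)] -/
theorem le_define (q : List Bool) (b : Bool) : σ ≤ σ.define q b := by
  intro q' b' hq'
  by_cases h : q' = q
  · subst h
    rw [val_define_self, hq', Option.getD_some]
  · rw [val_define_of_ne b h, hq']

/-- **Fresh strings**: a condition leaves undecided some string of any infinite set of strings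
(its domain is finite). [cite: FortnowRogers1999JCSS, §2.6 (arXiv numbering)] -/
theorem exists_not_mem_dom (σ : CohenCondition) {T : Set (List Bool)} (hT : T.Infinite) :
    ∃ q ∈ T, q ∉ σ.dom :=
  (hT.sdiff σ.dom_finite).nonempty

/-- The conditions deciding a given string form a dense set. [cite: FennerFortnowKurtzLi2003IC, Def. 3.3 (refining a condition to determine the oracle at any input)] -/
theorem isDense_setOf_mem_dom (q : List Bool) : IsCofinal {σ : CohenCondition | q ∈ σ.dom} :=
  fun τ => ⟨τ.define q false, mem_dom_define_self q false, le_define q false⟩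

/-- For an infinite set of strings `T` and a bit `b`, the conditions sending some string of `T` to
`b` form a dense set (extend at a fresh string of `T`) — the basic finite-extension step.
[cite: FortnowRogers1999JCSS, §2.6 (arXiv numbering)] [cite: FennerFortnowKurtzLi2003IC, §1 p. 3 (requirements met by finite extension)] -/
theorem isDense_setOf_exists_val_eq {T : Set (List Bool)} (hT : T.Infinite) (b : Bool) :
    IsCofinal {σ : CohenCondition | ∃ q ∈ T, σ.val q = some b} := by
  intro τ
  obtain ⟨q, hqT, hq⟩ := τ.exists_not_mem_dom hT
  exact ⟨τ.define q b, ⟨q, hqT, val_define_self_of_not_mem b hq⟩, le_define q b⟩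

/-! ### Directed sets of conditions have a common extension -/

/-- The oracle determined by a set `D` of conditions: the strings that some condition of `D`
makes true (for a generic filter this is "the oracle it builds").
[cite: FennerFortnowKurtzLi2003IC, Def. 3.7 and Lemma 3.12 (proof)] -/
def oracleOf (D : Set CohenCondition) : Language Bool :=
  {q | ∃ σ ∈ D, σ.val q = some true}

/-- Unfolding lemma for `oracleOf`. [folklore] -/
theorem mem_oracleOf_iff {D : Set CohenCondition} {q : List Bool} :
    q ∈ oracleOf D ↔ ∃ σ ∈ D, σ.val q = some true :=
  Iff.rfl

/-- **A directed set of conditions is simultaneously extended** by its oracle: pairwise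
compatible approximations assemble into one oracle (the step "`G` is a generic filter which
builds some element of `γ`" of the existence proof). [cite: FennerFortnowKurtzLi2003IC, Lemma 3.12 (proof) and Def. 3.6] -/
theorem extendedBy_oracleOf {D : Set CohenCondition} (hD : DirectedOn (· ≤ ·) D) (hσ : σ ∈ D) :
    σ.ExtendedBy (oracleOf D) := by
  intro q b hq
  constructor
  · rintro ⟨τ, hτ, hτq⟩
    obtain ⟨ρ, -, hσρ, hτρ⟩ := hD σ hσ τ hτ
    have h₁ := hσρ q b hq
    rw [hτρ q true hτq, Option.some.injEq] at h₁
    exact h₁.symm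
  · rintro rfl
    exact ⟨σ, hσ, hq⟩

end CohenCondition

/-! ### Genericity for a family of sets of conditions -/

open CohenCondition

/-- **`G` is generic for the family `𝒮`**: the oracle `G` meets every *dense* set of conditions
belonging to `𝒮` ("A generic oracle is one that meets every dense definable set of conditions" —
the printed notions are `𝒮 =` the definable sets, `Π¹₁` for Fortnow–Rogers, arithmetical for
Cohen genericity (Fenner–Fortnow–Kurtz–Li, Lemma 4.1), arithmetical in `B` for genericity
relative to an oracle `B` (ibid. §3.2); here the countable family is a parameter).
[cite: FortnowRogers1999JCSS, §2.6 (arXiv numbering)] [cite: FennerFortnowKurtzLi2003IC, Lemma 4.1 and §3.2] -/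
def IsGeneric (𝒮 : Set (Set CohenCondition)) (G : Language Bool) : Prop :=
  ∀ S ∈ 𝒮, IsDense S → Meets G S

/-- **Restricted genericity**: with conditions restricted to the class `P` ("Restrictions can be
set on conditions to achieve a desired separation", e.g. `UP ∩ coUP`-conditions), `G` is
`𝒮`-generic among `P`-conditions iff for every `S ∈ 𝒮` dense among `P`-conditions (every
`τ ∈ P` is extended by some `σ ∈ S ∩ P`, Mathlib's `IsCofinalFor P (S ∩ P)`) the oracle `G`
extends some `σ ∈ S ∩ P` ("A `UP ∩ coUP`-generic oracle is one that meets every dense definable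
set of `UP ∩ coUP`-conditions"). [cite: FortnowRogers1999JCSS, §2.6 (arXiv numbering)] -/
def IsGenericIn (P : Set CohenCondition) (𝒮 : Set (Set CohenCondition)) (G : Language Bool) : Prop :=
  ∀ S ∈ 𝒮, IsCofinalFor P (S ∩ P) → Meets G (S ∩ P)

section API

variable {𝒮 𝒮' : Set (Set CohenCondition)} {P : Set CohenCondition} {G : Language Bool}

/-- Unrestricted genericity is genericity among all conditions. [cite: FortnowRogers1999JCSS, §2.6 (arXiv numbering)] -/
theorem isGenericIn_univ : IsGenericIn Set.univ 𝒮 G ↔ IsGeneric 𝒮 G := by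
  refine forall₂_congr fun S _ => ?_
  simp only [Set.inter_univ]
  refine imp_congr ⟨fun h τ => ?_, fun h τ _ => h τ⟩ Iff.rfl
  exact h (Set.mem_univ τ)

/-- Genericity is antitone in the family: generic for more sets is generic for fewer. [folklore] -/
theorem IsGeneric.anti (h : 𝒮 ⊆ 𝒮') (hG : IsGeneric 𝒮' G) : IsGeneric 𝒮 G :=
  fun S hS => hG S (h hS)

/-- Restricted genericity is antitone in the family. [folklore] -/
theorem IsGenericIn.anti (h : 𝒮 ⊆ 𝒮') (hG : IsGenericIn P 𝒮' G) : IsGenericIn P 𝒮 G :=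
  fun S hS => hG S (h hS)

/-- Genericity for a union of families is genericity for both. [folklore] -/
theorem isGeneric_union : IsGeneric (𝒮 ∪ 𝒮') G ↔ IsGeneric 𝒮 G ∧ IsGeneric 𝒮' G :=
  ⟨fun h => ⟨h.anti Set.subset_union_left, h.anti Set.subset_union_right⟩,
    fun h S hS => hS.elim (h.1 S) (h.2 S)⟩

/-- Genericity for a countable union of families is genericity for each. [folklore] -/
theorem isGeneric_iUnion {ι : Sort*} {𝒯 : ι → Set (Set CohenCondition)} :
    IsGeneric (⋃ i, 𝒯 i) G ↔ ∀ i, IsGeneric (𝒯 i) G :=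
  ⟨fun h i => h.anti (Set.subset_iUnion 𝒯 i), fun h S hS => by
    obtain ⟨i, hi⟩ := Set.mem_iUnion.1 hS
    exact h i S hi⟩

/-- **The genericity lemma** (how requirements are met "by finite extension"): if the conditions
satisfying the requirement `R` form a dense set belonging to `𝒮`, then every `𝒮`-generic oracle
satisfies `R` ("We define the requirements so that, if each is satisfied, the proposition `P` is
true … If we construct an oracle `X` satisfying every `Rᵢ` then `P^X ≠ NP^X`").
[cite: FortnowRogers1999JCSS, §2.6 (arXiv numbering)] [cite: FennerFortnowKurtzLi2003IC, §1 p. 3] -/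
theorem IsGeneric.of_forces {R : Language Bool → Prop} (hG : IsGeneric 𝒮 G)
    (hmem : {σ : CohenCondition | σ.Forces R} ∈ 𝒮) (hd : IsDense {σ : CohenCondition | σ.Forces R}) :
    R G :=
  (hG _ hmem hd).of_forces fun _ h => h

/-- The same for a dense `S ∈ 𝒮` all of whose members force `R`. [cite: FortnowRogers1999JCSS, §2.6 (arXiv numbering)] -/
theorem IsGeneric.of_forces_of_mem {S : Set CohenCondition} {R : Language Bool → Prop}
    (hG : IsGeneric 𝒮 G) (hmem : S ∈ 𝒮) (hd : IsDense S) (hS : ∀ σ ∈ S, σ.Forces R) : R G :=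
  (hG S hmem hd).of_forces hS

/-- Restricted version of the genericity lemma. [cite: FortnowRogers1999JCSS, §2.6 (arXiv numbering)] -/
theorem IsGenericIn.of_forces_of_mem {S : Set CohenCondition} {R : Language Bool → Prop}
    (hG : IsGenericIn P 𝒮 G) (hmem : S ∈ 𝒮) (hd : IsCofinalFor P (S ∩ P))
    (hS : ∀ σ ∈ S, σ ∈ P → σ.Forces R) : R G :=
  (hG S hmem hd).of_forces fun σ hσ => hS σ hσ.1 hσ.2

end API

/-! ### Existence of generic oracles for countable families (Fenner–Fortnow–Kurtz–Li, Lemma 3.12) -/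

section Existence

variable {𝒮 : Set (Set CohenCondition)} {P : Set CohenCondition}

/-- **Existence of generic oracles, restricted conditions.** For a countable family `𝒮` of sets
of conditions and a class `P` of admissible conditions, every `σ₀ ∈ P` is extended by an oracle
`G` that is `𝒮`-generic among `P`-conditions. Proof: the Rasiowa–Sikorski lemma in the poset
`P` (Mathlib's `Order.idealOfCofinals` — the chain `γ₋₁ ⊇ γ₀ ⊇ γ₁ ⊇ ⋯` of the printed proof)
gives an ideal of `P`-conditions through `σ₀` meeting each of the countably many dense
`S ∩ P`, `S ∈ 𝒮`; being directed it is extended by one oracle (`extendedBy_oracleOf`).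
[cite: FennerFortnowKurtzLi2003IC, Lemma 3.12 (p. 11)] [cite: FortnowRogers1999JCSS, §2.6 (arXiv numbering)] -/
theorem exists_extendedBy_isGenericIn (h𝒮 : 𝒮.Countable) {σ₀ : CohenCondition} (hσ₀ : σ₀ ∈ P) :
    ∃ G : Language Bool, σ₀.ExtendedBy G ∧ IsGenericIn P 𝒮 G := by
  classical
  -- the countably many relevant dense sets, as cofinal subsets of the poset `P`
  let T : Set (Set CohenCondition) := {S | S ∈ 𝒮 ∧ IsCofinalFor P (S ∩ P)}
  haveI : Encodable T := (h𝒮.mono fun S (hS : S ∈ T) => hS.1).toEncodable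
  let 𝒟 : T → Order.Cofinal P := fun S =>
    { carrier := {x : P | (x : CohenCondition) ∈ (S : Set CohenCondition)}
      isCofinal := fun x => by
        obtain ⟨σ, ⟨hσS, hσP⟩, hxσ⟩ := S.2.2 x.2
        exact ⟨⟨σ, hσP⟩, hσS, hxσ⟩ }
  let I : Order.Ideal P := Order.idealOfCofinals ⟨σ₀, hσ₀⟩ 𝒟
  -- the conditions of the ideal, as a directed set of conditions
  let D : Set CohenCondition := Subtype.val '' (I : Set P)
  have hD : DirectedOn (· ≤ ·) D := by
    rintro _ ⟨x, hx, rfl⟩ _ ⟨y, hy, rfl⟩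
    obtain ⟨z, hz, hxz, hyz⟩ := I.directed x hx y hy
    exact ⟨z, ⟨z, hz, rfl⟩, hxz, hyz⟩
  refine ⟨oracleOf D, extendedBy_oracleOf hD ⟨⟨σ₀, hσ₀⟩, Order.mem_idealOfCofinals _ 𝒟, rfl⟩,
    fun S hS hcof => ?_⟩
  obtain ⟨x, hxS, hxI⟩ := Order.cofinal_meets_idealOfCofinals ⟨σ₀, hσ₀⟩ 𝒟 ⟨S, hS, hcof⟩
  exact ⟨x, ⟨hxS, x.2⟩, extendedBy_oracleOf hD ⟨x, hxI, rfl⟩⟩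

/-- **Existence of generic oracles** ("the set of generic sets is dense": every condition is
extended by a generic oracle), for a countable family `𝒮` of sets of conditions.
[cite: FennerFortnowKurtzLi2003IC, Lemma 3.12 (p. 11)] [cite: FortnowRogers1999JCSS, §2.6 (arXiv numbering)] -/
theorem exists_extendedBy_isGeneric (h𝒮 : 𝒮.Countable) (σ₀ : CohenCondition) :
    ∃ G : Language Bool, σ₀.ExtendedBy G ∧ IsGeneric 𝒮 G := by
  obtain ⟨G, hσ₀, hG⟩ := exists_extendedBy_isGenericIn h𝒮 (Set.mem_univ σ₀)
  exact ⟨G, hσ₀, isGenericIn_univ.1 hG⟩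

/-- Generic oracles for countable families exist. [cite: FennerFortnowKurtzLi2003IC, Lemma 3.12 (p. 11)] -/
theorem exists_isGeneric (h𝒮 : 𝒮.Countable) : ∃ G : Language Bool, IsGeneric 𝒮 G := by
  obtain ⟨G, -, hG⟩ := exists_extendedBy_isGeneric h𝒮 ⊥
  exact ⟨G, hG⟩

/-- Generic oracles among `P`-conditions exist as soon as `P` is nonempty.
[cite: FennerFortnowKurtzLi2003IC, Lemma 3.12 (p. 11)] [cite: FortnowRogers1999JCSS, §2.6 (arXiv numbering)] -/
theorem exists_isGenericIn (h𝒮 : 𝒮.Countable) (hP : P.Nonempty) :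
    ∃ G : Language Bool, IsGenericIn P 𝒮 G := by
  obtain ⟨σ₀, hσ₀⟩ := hP
  obtain ⟨G, -, hG⟩ := exists_extendedBy_isGenericIn h𝒮 hσ₀
  exact ⟨G, hG⟩

/-- A requirement met by finite extension holds for some oracle: if the conditions forcing `R`
are dense, some oracle satisfies `R` (genericity for the one-element family).
[cite: FortnowRogers1999JCSS, §2.6 (arXiv numbering)] -/
theorem exists_of_isDense_forces {R : Language Bool → Prop}
    (hd : IsDense {σ : CohenCondition | σ.Forces R}) : ∃ G : Language Bool, R G := by
  obtain ⟨G, hG⟩ := exists_isGeneric (Set.countable_singleton {σ : CohenCondition | σ.Forces R})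
  exact ⟨G, hG.of_forces (Set.mem_singleton _) hd⟩

/-- Countably many requirements, each met by finite extension (dense forcing sets), are met
simultaneously by some oracle — the modularity of generic-oracle proofs ("One no longer needs to
worry about how to interleave requirements explicitly"). [cite: FennerFortnowKurtzLi2003IC, §1 pp. 2–3] [cite: FortnowRogers1999JCSS, §2.6 (arXiv numbering)] -/
theorem exists_forall_of_isDense_forces {R : ℕ → Language Bool → Prop}
    (hd : ∀ i, IsDense {σ : CohenCondition | σ.Forces (R i)}) : ∃ G : Language Bool, ∀ i, R i G := by
  obtain ⟨G, hG⟩ := exists_isGeneric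
    (Set.countable_range fun i => {σ : CohenCondition | σ.Forces (R i)})
  exact ⟨G, fun i => hG.of_forces (Set.mem_range_self i) (hd i)⟩

end Existence

end Literature.Computability.Complexity
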